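import Mathlib.RingTheory.MvPolynomial.Homogeneous
import Mathlib.Algebra.MvPolynomial.PDeriv
import Mathlib.RingTheory.PowerSeries.Basic
import Mathlib.RingTheory.Ideal.Height
import Mathlib.RingTheory.Ideal.MinimalPrime.Basic
import Mathlib.LinearAlgebra.Matrix.Determinant.Basic
import HarnessLib

/-!
# Embedded one-parameter smoothings of projective schemes over `k⟦t⟧`, in equations

Topic: `Literature/AlgebraicGeometry/Deformation`. A **deformation** of a scheme `X₀` is a flat
family `𝔛 → S` with `X₀ ≅ 𝔛 ×_S 0` (Stevens, *Deformations of singularities*, Ch. 1: "a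
deformation of `X₀` is a flat map `π : X → S` with `X₀ ≅ π⁻¹(0)`"); a **one-parameter smoothing**
is a deformation over a smooth curve germ / the formal disc `Spec k⟦t⟧` whose general fibre is
smooth (loc. cit., Ch. 13; for Stanley–Reisner schemes: Altmann–Christophersen 2009, §1 —
"smoothings of Stanley–Reisner schemes associated to combinatorial manifolds yield interesting
algebraic geometric varieties … if the complex is a triangulated sphere then the smoothing (if
possible) would be Calabi–Yau").

This file writes the EMBEDDED, PROJECTIVE version purely in commutative algebra, as a predicate on
a pair of ideals — the form in which such smoothings are computed (lifting equations and
relations order by order, Stevens Ch. 1 and Ch. 3) and in which route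
`Summits/SmoothPoincare4/…/Theses/LogCYSkeleton` (crux `StanleyReisnerRealisation`) states them:
for a homogeneous ideal `I ≤ k[x_v : v ∈ V]` (the projective scheme `X₀ = Proj k[x]/I ⊆ ℙ^{|V|-1}_k`)
and an ideal `J ≤ k⟦t⟧[x_v : v ∈ V]` (the total space `𝔛 = Proj k⟦t⟧[x]/J ⊆ ℙ^{|V|-1}_{k⟦t⟧}`,
an honest projective scheme over `Spec k⟦t⟧`), `IsFormalEmbeddedSmoothing k c I J` says:

1. `homogeneous` — `J` is homogeneous in `x` (so `𝔛 ⊆ ℙ_{k⟦t⟧}` makes sense);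
2. `torsionFree` — `t · f ∈ J ⇒ f ∈ J`: `k⟦t⟧[x]/J` is `t`-torsion-free, i.e. FLAT over the
   discrete valuation ring `k⟦t⟧` (`k` a field; flat = torsion-free over a PID,
   Hartshorne III Example 9.1.3);
3. `specialFibre` — `J ↦ I` under `t ↦ 0`: the fibre of `𝔛` over the closed point is `X₀`;
4. `height_eq` — every minimal prime of `J` not containing `t` has height `c`: the generic
   fibre `𝔛_η ⊆ ℙ_{k((t))}` (primes of `k⟦t⟧[x][1/t] = k((t))[x]`… restricted from `k⟦t⟧[x]`) has
   affine cone of PURE codimension `c`, i.e. `𝔛_η` is equidimensional of dimension `|V| - 1 - c`;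
5. `jacobian` — for every variable `x_v` some `t^m x_v^n` lies in `J + I_c(∂J)`, `I_c(∂J)` the
   ideal of `c × c` minors of Jacobian matrices of `c`-tuples from `J` (`jacobianMinorIdeal`):
   after inverting `t`, `J + I_c(∂J)` contains a power of the irrelevant ideal, i.e. NO point of
   `𝔛_η` is singular — the **Jacobian criterion** for smoothness of the generic fibre in pure
   codimension `c` (Hartshorne I §5 Definition and Ex. 5.8 for projective varieties; Eisenbud
   Thm. 16.19; smoothness over the possibly imperfect field `k((t))` is exactly the rank
   condition).

So, for `k` a field, `IsFormalEmbeddedSmoothing k c I J` ⟺ "`Proj k⟦t⟧[x]/J → Spec k⟦t⟧` is a flat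
projective family with special fibre `Proj k[x]/I` and smooth generic fibre of pure dimension
`|V| - 1 - c`", an embedded smoothing of `X₀` over the formal disc; `HasFormalEmbeddedSmoothing k c I`
quantifies `J` away. The codimension `c` is a parameter (for the Stanley–Reisner scheme of a
`d`-dimensional complex on `f₀` vertices, `c = f₀ - d - 1`) to avoid truncated subtraction.

API: `jacobianMinorIdeal_mono`, `IsFormalEmbeddedSmoothing.isHomogeneous_iff` (clause 1 is
Mathlib's `Ideal.IsHomogeneous` for the grading by degree in `x`), `.C_X_pow_mul_mem_iff`
(torsion-freeness for powers of `t`), `.ne_top` and `.exists_minimalPrime_not_mem` (if `I ≠ ⊤` the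
generic fibre is NONEMPTY: some minimal prime of `J` avoids `t`, since otherwise `t ∈ √J` and
torsion-freeness would give `1 ∈ J`).

Not here (deliberately): the comparison with ABSTRACT smoothings (a flat proper `𝔛 → Spec k⟦t⟧`
with `𝔛₀ ≅ X₀` need not be embedded compatibly with `𝒪(1)` — deformations of the pair `(X, L)`,
Altmann–Christophersen 2009, §3, Thm. 3.1 — so "embedded" is part of the notion, not a theorem);
formal (adic) versus algebraic families (here `J` is an ideal of polynomials over `k⟦t⟧`, an
algebraic family over the complete base, so no Grothendieck existence is involved); versality,
`T¹`/`T²`.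

## References

* J. Stevens, *Deformations of Singularities*, LNM 1811 (2003): Ch. 1 (deformations as flat
  families, one-parameter deformations, lifting relations), Ch. 13 (smoothing components).
  [Stevens2003]
* K. Altmann, J. A. Christophersen, *Deforming Stanley–Reisner schemes*, arXiv:0901.2502,
  §1, §3. [AltmannChristophersen2009]
* R. Hartshorne, *Algebraic Geometry*, GTM 52 (1977): I §5 (Definition, p. 32), I Ex. 5.8,
  III Example 9.1.3 (flat over a PID ⟺ torsion-free). [Hartshorne1977]
* D. Eisenbud, *Commutative Algebra with a View Toward Algebraic Geometry*, GTM 150 (1995):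
  Thm. 16.19 (Jacobian criterion), §16.6. [Eisenbud1995]
-/

noncomputable section

open MvPolynomial

attribute [local instance] MvPolynomial.gradedAlgebra

namespace Literature.AlgebraicGeometry.Deformation

universe u v

/-! ## Jacobian minors -/

section Jacobian

variable {R : Type u} [CommRing R] {V : Type v}

/-- The **ideal of `c × c` Jacobian minors** of an ideal `J ≤ R[x_v : v ∈ V]`: generated by the
determinants `det (∂gᵢ/∂x_{v_j})_{i,j < c}` for all `c`-tuples `g` of elements of `J` and all
`c`-tuples `v` of distinct variables. Modulo `J` this is the ideal of `c × c` minors of the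
Jacobian matrix of any generating set of `J` (rows of `∂(Σ aₗ fₗ)` are combinations of the rows
`∂fₗ` modulo `J`), so `J + jacobianMinorIdeal c J` is the classical Jacobian (singular-locus)
ideal in codimension `c`, independent of generators (Hartshorne I §5: `Y` is nonsingular at
`P` iff the Jacobian matrix has rank `n - dim Y` at `P`; I Ex. 5.8 for the projective version).
[cite: Hartshorne1977, I Ex. 5.8] -/
def jacobianMinorIdeal (c : ℕ) (J : Ideal (MvPolynomial V R)) : Ideal (MvPolynomial V R) :=
  Ideal.span {d | ∃ (g : Fin c → MvPolynomial V R) (x : Fin c → V),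
    (∀ i, g i ∈ J) ∧ Function.Injective x ∧
      d = (Matrix.of fun i j => pderiv (x j) (g i)).det}

/-- A Jacobian minor of a tuple from `J` lies in `jacobianMinorIdeal c J`. [folklore] -/
theorem det_mem_jacobianMinorIdeal {c : ℕ} {J : Ideal (MvPolynomial V R)}
    (g : Fin c → MvPolynomial V R) (x : Fin c → V) (hg : ∀ i, g i ∈ J)
    (hx : Function.Injective x) :
    (Matrix.of fun i j => pderiv (x j) (g i)).det ∈ jacobianMinorIdeal c J :=
  Ideal.subset_span ⟨g, x, hg, hx, rfl⟩

/-- The Jacobian minor ideal is monotone in `J`. [folklore] -/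
theorem jacobianMinorIdeal_mono (c : ℕ) {J J' : Ideal (MvPolynomial V R)} (h : J ≤ J') :
    jacobianMinorIdeal c J ≤ jacobianMinorIdeal c J' := by
  refine Ideal.span_mono ?_
  rintro d ⟨g, x, hg, hx, rfl⟩
  exact ⟨g, x, fun i => h (hg i), hx, rfl⟩

/-- In codimension `0` the (empty) minor is `1`: `jacobianMinorIdeal 0 J = ⊤`. [folklore] -/
theorem jacobianMinorIdeal_zero (J : Ideal (MvPolynomial V R)) : jacobianMinorIdeal 0 J = ⊤ := by
  rw [Ideal.eq_top_iff_one]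
  have h := det_mem_jacobianMinorIdeal (J := J) Fin.elim0 Fin.elim0 (fun i => i.elim0)
    (Function.injective_of_subsingleton _)
  simpa [Matrix.det_fin_zero] using h

end Jacobian

/-! ## Embedded smoothings over `k⟦t⟧` -/

section Smoothing

variable (k : Type u) [CommRing k] {V : Type v}

/-- **Embedded one-parameter (formal-disc) smoothing, in equations.** For ideals
`I ≤ k[x_v : v ∈ V]` and `J ≤ k⟦t⟧[x_v : v ∈ V]` and a codimension `c`:
`J` is homogeneous in `x`; `k⟦t⟧[x]/J` is `t`-torsion-free (= flat over `k⟦t⟧`); `J` reduces to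
`I` modulo `t`; every minimal prime of `J` not containing `t` has height `c`; and for every
variable `x_v` some `t^m x_v^n` lies in `J +` (the `c × c` Jacobian minors of `J`). For `k` a field
this says: `Proj (k⟦t⟧[x]/J) → Spec k⟦t⟧` is a flat projective family with special fibre
`Proj (k[x]/I)` whose generic fibre is smooth of pure codimension `c` in `ℙ^{|V|-1}_{k((t))}` — a
smoothing of `Proj (k[x]/I)` over the formal disc, embedded in projective space (see the module
docstring for the dictionary and sources). [folklore] -/
structure IsFormalEmbeddedSmoothing (c : ℕ) (I : Ideal (MvPolynomial V k))
    (J : Ideal (MvPolynomial V (PowerSeries k))) : Prop where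
  /-- `J` is homogeneous for the grading by degree in `x` (coefficients in `k⟦t⟧`). -/
  homogeneous : ∀ f ∈ J, ∀ d : ℕ, homogeneousComponent d f ∈ J
  /-- `t` is a non-zero-divisor modulo `J` (flatness over `k⟦t⟧`). -/
  torsionFree : ∀ f : MvPolynomial V (PowerSeries k), C PowerSeries.X * f ∈ J → f ∈ J
  /-- Setting `t = 0` maps `J` onto `I` (the special fibre is `Proj k[x]/I`). -/
  specialFibre : J.map (MvPolynomial.map (PowerSeries.constantCoeff (R := k))) = I
  /-- The generic fibre has pure codimension `c`: minimal primes of `J` avoiding `t` have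
  height `c`. -/
  height_eq : ∀ P ∈ J.minimalPrimes, C PowerSeries.X ∉ P → P.height = c
  /-- Jacobian criterion on the generic fibre: `J + I_c(∂J)` is irrelevant after inverting `t`. -/
  jacobian : ∀ v : V, ∃ n m : ℕ,
    C PowerSeries.X ^ m * X v ^ n ∈ J ⊔ jacobianMinorIdeal c J

/-- `Proj (k[x]/I)` **admits an embedded smoothing over `k⟦t⟧`** with generic fibre of pure
codimension `c`. [folklore] -/
def HasFormalEmbeddedSmoothing (c : ℕ) (I : Ideal (MvPolynomial V k)) : Prop :=
  ∃ J : Ideal (MvPolynomial V (PowerSeries k)), IsFormalEmbeddedSmoothing k c I J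

variable {k}

/-- Clause 1 in Mathlib's language: an ideal of `S[x_V]` is stable under taking homogeneous
components iff it is a homogeneous ideal for the grading by degree
(`MvPolynomial.homogeneousSubmodule`). [folklore] -/
theorem isHomogeneous_iff_forall_homogeneousComponent_mem {S : Type*} [CommRing S]
    (J : Ideal (MvPolynomial V S)) :
    J.IsHomogeneous (homogeneousSubmodule V S) ↔ ∀ f ∈ J, ∀ d : ℕ, homogeneousComponent d f ∈ J := by
  refine ⟨fun h f hf d => homogeneousComponent_mem_of_mem h hf d, fun h i f hf => ?_⟩
  rw [← DirectSum.Decomposition.decompose'_eq, decomposition.decompose'_apply]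
  exact h f hf i

namespace IsFormalEmbeddedSmoothing

variable {c : ℕ} {I : Ideal (MvPolynomial V k)} {J : Ideal (MvPolynomial V (PowerSeries k))}

/-- The total-space ideal of an embedded smoothing is a homogeneous ideal of `k⟦t⟧[x]`.
[folklore] -/
theorem isHomogeneous (h : IsFormalEmbeddedSmoothing k c I J) :
    J.IsHomogeneous (homogeneousSubmodule V (PowerSeries k)) :=
  (isHomogeneous_iff_forall_homogeneousComponent_mem J).2 h.homogeneous

/-- Torsion-freeness for powers of `t`: `t^m f ∈ J ↔ f ∈ J`. [folklore] -/
theorem C_X_pow_mul_mem_iff (h : IsFormalEmbeddedSmoothing k c I J) (m : ℕ)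
    (f : MvPolynomial V (PowerSeries k)) :
    C PowerSeries.X ^ m * f ∈ J ↔ f ∈ J := by
  refine ⟨fun hf => ?_, fun hf => J.mul_mem_left _ hf⟩
  induction m with
  | zero => simpa using hf
  | succ m ih =>
    refine ih (h.torsionFree _ ?_)
    rwa [← mul_assoc, ← pow_succ']

/-- If the special fibre is a proper subscheme's ideal (`I ≠ ⊤`) then `J ≠ ⊤`. [folklore] -/
theorem ne_top (h : IsFormalEmbeddedSmoothing k c I J) (hI : I ≠ ⊤) : J ≠ ⊤ := by
  rintro rfl
  apply hI
  rw [← h.specialFibre, Ideal.map_top]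

/-- **The generic fibre is nonempty**: if `I ≠ ⊤`, some minimal prime of `J` does not contain
`t` (otherwise `t ∈ ⋂ P = √J`, so `t^m ∈ J` and, by torsion-freeness, `1 ∈ J`). [folklore] -/
theorem exists_minimalPrime_not_mem (h : IsFormalEmbeddedSmoothing k c I J) (hI : I ≠ ⊤) :
    ∃ P ∈ J.minimalPrimes, C PowerSeries.X ∉ P := by
  by_contra hall
  push Not at hall
  have hrad : C PowerSeries.X ∈ J.radical := by
    rw [← Ideal.sInf_minimalPrimes]
    exact Submodule.mem_sInf.2 hall
  obtain ⟨m, hm⟩ := hrad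
  refine h.ne_top hI ((Ideal.eq_top_iff_one _).2 ?_)
  exact (h.C_X_pow_mul_mem_iff m 1).1 (by simpa using hm)

end IsFormalEmbeddedSmoothing

end Smoothing

end Literature.AlgebraicGeometry.Deformation
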